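import Summits.CriticalPhenomena.PercolationContinuityZ3.Theorems.PercAnnulusCrossingHarrisSlackBounds
import Summits.CriticalPhenomena.PercolationContinuityZ3.Theorems.PercAnnulusCrossingBoundedLengthExtremal
import HarnessLib

/-!
# RSW3 lane (lead, gen 25): QUANTITATIVE HARRIS WITH LOGARITHMIC LOSS, II — on every biased cube (degenerate coordinates allowed):
# `E[fg] − E[f]E[g] ≥ a₁ / (40·log² max(e², σ_f σ_g / a₁))`, `a₁ = Σ_i p_i(1−p_i)·E[D_i f]·E[D_i g]`, for coordinatewise non-decreasing `f, g`

builds on p205010 (kernel theorem, internal audit signed; external expert review pending) — NOT used in this file (abstract).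

Cell `prim-rsw3` (LANE 3), lead seat, gen 25.  Support file (`--supports stmt-CriticalPhenomena-4575`); no definitions, no named facts,
no sorries.  Setting of gen 23 (`…HarrisSlack`, `…HarrisSlackBounds`): finite product cube `ι → Bool`, biases `p ∈ [0,1]^ι`, product weight
`wt p`, the p-biased characters, coefficients `f̂(S)`, the `ε`-noised copy `ω^ε`, the discrete derivative `D_i h(x) = h(x^{i→1}) − h(x^{i→0})`.
Gen 23 wrote the Harris slack as `E[fg] − E f E g = q(1) − q(0)` for the CORRELATION FUNCTION `q(t) = E[f(ω)·g(ω^{1−t})] = Σ_S t^{|S|} f̂(S)ĝ(S)`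
(mixed spectral formula) and proved `q` non-decreasing on `[0,1]` for monotone pairs (De–Nadimpalli–Servedio's "monotone compatibility" of the
Bonami–Beckner semigroup with monotone functions); its quantitative Harris inequality (`…HarrisSlackLower`) paid a POLYNOMIAL price
`(r/ρ₀)²(ts)^{3/4}` for the single hypercontractive level available.  Here the De–Nadimpalli–Servedio extremal lemma of part I
(`Extremal.eval_one_ge_of_monotone`: a power series with `c_1 = 1`, length `≤ M`, `0 ≤ p ≤ p(1)` on `[0,1]` has `p(1) ≥ 1/(40 log² max(e²,M))`)
is applied to `p(t) = (q(t) − q(0))/a₁`, whose length is `≤ σ_f σ_g/a₁` by Cauchy–Schwarz and Parseval: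

* §1 `sum_powerset_pow_card_mul_eq` — regrouping `Σ_S t^{|S|}Φ(S) = Σ_ℓ t^ℓ Σ_{|S|=ℓ} Φ(S)`; `noise_cross_correlation_eq_sum_levels` — `q(t) =
  Σ_{ℓ} t^ℓ a_ℓ`, `a_ℓ = Σ_{|S|=ℓ} f̂(S)ĝ(S)`; `level_zero_eq` (`a₀ = E f·E g`), **`level_one_eq`** (`a₁ = Σ_i p_i(1−p_i)E[D_i f]E[D_i g]` — the
  joint level-1 weight is the `p(1−p)`-weighted inner product of the influence vectors); `sum_abs_level_le` (`Σ_{ℓ≥1}|a_ℓ| ≤ σ_f σ_g`).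
* §2 **`cov_ge_level_one_div_log_sq`** — THE QUANTITATIVE HARRIS INEQUALITY WITH LOGARITHMIC LOSS: for coordinatewise non-decreasing real
  `f, g` on the p-biased cube, EVERY `p ∈ [0,1]^ι`,
  **`E[fg] − E[f]E[g] ≥ a₁ / (40·log²(max(e², σ_f σ_g/a₁)))`**, `σ² = Var` — Talagrand's 1996 correlation inequality
  `Cov ≥ c·φ(Σ I_i(A)I_i(B))`, `φ(x) = x/log(e/x)`, up to one logarithm, with NO dependence on the bias and no hypercontractivity
  (De–Nadimpalli–Servedio 2021 Thm 15/41: `Φ(x) = min(x, x/log²(1/x))`); `cov_ge_level_one_div_log_sq_of_le` — the same with any upper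
  bound `V ≥ σ_f σ_g` (e.g. `1/4` for two events).  Part III (lattice) turns `a₁` into `p(1−p)·Σ_z P(z piv A)·P(z piv B)`.

References: A. De, S. Nadimpalli, R. A. Servedio, ITCS 2021 Art. 69 = arXiv:2012.12216, Thm 15, §6 Thm 41 (finite product spaces)
[cite: DeNadimpalliServedio2021, Thm 15 / Thm 41]; M. Talagrand, *How much are increasing sets positively correlated?*, Combinatorica 16
(1996) 243–258, Thm 1.1; N. Keller, E. Mossel, A. Sen, *Geometric influences II*, Ann. Inst. H. Poincaré 50 (2014) (p-biased versions with
p-dependent constants); R. O'Donnell, *Analysis of Boolean Functions*, CUP 2014, §2.4, §8.4.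
-/

noncomputable section

namespace Summit.CriticalPhenomena.PercolationContinuityZ3.Theorems.Crossing.Spectral

open Finset Function MeasureTheory
open Literature.Probability.ODonnellSaksSchrammServedio2005

variable {ι : Type*} [Fintype ι] [DecidableEq ι]

/-! ## §1 Levels of the mixed spectral formula -/

omit [DecidableEq ι] in
/-- Regrouping a sum over subsets by cardinality: `Σ_S t^{|S|}·Φ(S) = Σ_{ℓ ≤ |ι|} t^ℓ·Σ_{|S| = ℓ} Φ(S)`. -/
theorem sum_powerset_pow_card_mul_eq (Φ : Finset ι → ℝ) (t : ℝ) :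
    ∑ S ∈ (Finset.univ : Finset ι).powerset, t ^ S.card * Φ S
      = ∑ ℓ ∈ Finset.range (Fintype.card ι + 1), t ^ ℓ * ∑ S ∈ Finset.powersetCard ℓ (Finset.univ : Finset ι), Φ S := by
  rw [Finset.powerset_card_disjiUnion, Finset.sum_disjiUnion, Finset.card_univ]
  refine Finset.sum_congr rfl fun ℓ _ => ?_
  rw [Finset.mul_sum]
  refine Finset.sum_congr rfl fun S hS => ?_
  rw [(Finset.mem_powersetCard.1 hS).2]

section Characters

variable {p : ι → ℝ} {r : ι → Bool → ℝ}
  (hH1 : ∀ i, p i * r i true + (1 - p i) * r i false = 0)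
  (hH2 : ∀ i (b b' : Bool), coordWt p i b ≠ 0 → coordWt p i b' * (1 + r i b * r i b') = if b' = b then 1 else 0)

include hH1 hH2 in
/-- **The correlation function by levels**: `E[f(ω)·g(ω^{1−t})] = Σ_{ℓ ≤ |ι|} t^ℓ·a_ℓ` with `a_ℓ = Σ_{|S| = ℓ} f̂(S)ĝ(S)` (the mixed spectral
formula of gen 23 regrouped by level), every real `t`.  [cite: DeNadimpalliServedio2021, §4 (4) (⟨P_t f, g⟩ = Σ_ℓ a_ℓ λ_t^ℓ)] -/
theorem noise_cross_correlation_eq_sum_levels (f g : (ι → Bool) → ℝ) (t : ℝ) :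
    ∑ x : ι → Bool, ∑ y : ι → Bool, ∑ m : ι → Bool, wt p x * wt p y * wt (fun _ => 1 - t) m
        * (f x * g (fun i => if m i = true then y i else x i))
      = ∑ ℓ ∈ Finset.range (Fintype.card ι + 1), t ^ ℓ
          * ∑ S ∈ Finset.powersetCard ℓ (Finset.univ : Finset ι),
              (∑ x : ι → Bool, wt p x * (f x * ∏ i ∈ S, r i (x i))) * (∑ x : ι → Bool, wt p x * (g x * ∏ i ∈ S, r i (x i))) := by
  rw [noise_cross_correlation_eq_sum_coeff hH1 hH2 f g (1 - t), ← sum_powerset_pow_card_mul_eq]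
  refine Finset.sum_congr rfl fun S _ => ?_
  rw [sub_sub_cancel]

/-- Level `0`: `a₀ = f̂(∅)ĝ(∅) = E[f]·E[g]`. -/
theorem level_zero_eq (f g : (ι → Bool) → ℝ) :
    ∑ S ∈ Finset.powersetCard 0 (Finset.univ : Finset ι),
        (∑ x : ι → Bool, wt p x * (f x * ∏ i ∈ S, r i (x i))) * (∑ x : ι → Bool, wt p x * (g x * ∏ i ∈ S, r i (x i)))
      = (∑ x : ι → Bool, wt p x * f x) * (∑ x : ι → Bool, wt p x * g x) := by
  rw [Finset.powersetCard_zero, Finset.sum_singleton]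
  simp

include hH1 hH2 in
/-- **Level `1` is the influence inner product**: `a₁ = Σ_i f̂({i})ĝ({i}) = Σ_i p_i(1−p_i)·E[D_i f]·E[D_i g]`
(`f̂({i}) = p_i r_i(1)·E[D_i f]`, `(p_i r_i(1))² = p_i(1−p_i)`).
[cite: ODonnell2014, §8.4 Prop 8.45 (f̂(i) = σ_i·E[D_i f] in the p-biased basis)] [cite: DeNadimpalliServedio2021, §6.4 (a₁ = Σ_i ⟨f_i, g_i⟩)] -/
theorem level_one_eq (f g : (ι → Bool) → ℝ) :
    ∑ S ∈ Finset.powersetCard 1 (Finset.univ : Finset ι),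
        (∑ x : ι → Bool, wt p x * (f x * ∏ i ∈ S, r i (x i))) * (∑ x : ι → Bool, wt p x * (g x * ∏ i ∈ S, r i (x i)))
      = ∑ i, p i * (1 - p i) * ((∑ x : ι → Bool, wt p x * (f (update x i true) - f (update x i false)))
          * (∑ x : ι → Bool, wt p x * (g (update x i true) - g (update x i false)))) := by
  rw [Finset.powersetCard_one, Finset.sum_map]
  refine Finset.sum_congr rfl fun i _ => ?_
  simp only [Function.Embedding.coeFn_mk]
  have hf := coeff_insert_eq_bias_mul hH1 f (S := ∅) (i := i) (Finset.notMem_empty i)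
  have hg := coeff_insert_eq_bias_mul hH1 g (S := ∅) (i := i) (Finset.notMem_empty i)
  simp only [insert_empty_eq, Finset.prod_singleton, Finset.prod_empty, mul_one] at hf hg ⊢
  rw [hf, hg, ← sq_bias_mul_char_eq hH2 i]
  ring

include hH2 in
/-- **The correlation function has length at most `σ_f σ_g`**: `Σ_{1 ≤ ℓ ≤ |ι|} |a_ℓ| ≤ Σ_{S ≠ ∅} |f̂(S)||ĝ(S)| ≤ √Var(f)·√Var(g)`
(Cauchy–Schwarz over `S ≠ ∅` and Parseval `Σ_{S≠∅} f̂(S)² = E f² − (E f)²`). [cite: DeNadimpalliServedio2021, §4 (Σ_ℓ |a_ℓ| ≤ ‖f‖‖g‖)] -/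
theorem sum_abs_level_le (f g : (ι → Bool) → ℝ) :
    ∑ n ∈ Finset.range (Fintype.card ι), |∑ S ∈ Finset.powersetCard (n + 1) (Finset.univ : Finset ι),
        (∑ x : ι → Bool, wt p x * (f x * ∏ i ∈ S, r i (x i))) * (∑ x : ι → Bool, wt p x * (g x * ∏ i ∈ S, r i (x i)))|
      ≤ Real.sqrt ((∑ x : ι → Bool, wt p x * (f x * f x)) - (∑ x : ι → Bool, wt p x * f x) ^ 2)
        * Real.sqrt ((∑ x : ι → Bool, wt p x * (g x * g x)) - (∑ x : ι → Bool, wt p x * g x) ^ 2) := by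
  -- abbreviations for the coefficients
  obtain ⟨F, hF⟩ : ∃ F : Finset ι → ℝ, F = fun S => ∑ x : ι → Bool, wt p x * (f x * ∏ j ∈ S, r j (x j)) := ⟨_, rfl⟩
  obtain ⟨G, hG⟩ : ∃ G : Finset ι → ℝ, G = fun S => ∑ x : ι → Bool, wt p x * (g x * ∏ j ∈ S, r j (x j)) := ⟨_, rfl⟩
  have hFS : ∀ S, ∑ x : ι → Bool, wt p x * (f x * ∏ j ∈ S, r j (x j)) = F S := fun S => by rw [hF]
  have hGS : ∀ S, ∑ x : ι → Bool, wt p x * (g x * ∏ j ∈ S, r j (x j)) = G S := fun S => by rw [hG]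
  simp only [hFS, hGS]
  -- `Σ_{ℓ ≥ 1} |a_ℓ| ≤ Σ_{S ≠ ∅} |F||G|`
  have hstep1 : ∑ n ∈ Finset.range (Fintype.card ι), |∑ S ∈ Finset.powersetCard (n + 1) (Finset.univ : Finset ι), F S * G S|
      ≤ ∑ S ∈ (Finset.univ : Finset ι).powerset.erase ∅, |F S| * |G S| := by
    have hre : ∑ S ∈ (Finset.univ : Finset ι).powerset, (1 : ℝ) ^ S.card * (|F S| * |G S|)
        = ∑ ℓ ∈ Finset.range (Fintype.card ι + 1), (1 : ℝ) ^ ℓ * ∑ S ∈ Finset.powersetCard ℓ (Finset.univ : Finset ι), |F S| * |G S| :=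
      sum_powerset_pow_card_mul_eq (fun S => |F S| * |G S|) 1
    simp only [one_pow, one_mul] at hre
    rw [Finset.sum_range_succ', Finset.powersetCard_zero, Finset.sum_singleton] at hre
    have hsplit : ∑ S ∈ (Finset.univ : Finset ι).powerset, |F S| * |G S|
        = |F ∅| * |G ∅| + ∑ S ∈ (Finset.univ : Finset ι).powerset.erase ∅, |F S| * |G S| :=
      (Finset.add_sum_erase _ _ (Finset.empty_mem_powerset _)).symm
    calc ∑ n ∈ Finset.range (Fintype.card ι), |∑ S ∈ Finset.powersetCard (n + 1) (Finset.univ : Finset ι), F S * G S|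
        ≤ ∑ n ∈ Finset.range (Fintype.card ι), ∑ S ∈ Finset.powersetCard (n + 1) (Finset.univ : Finset ι), |F S| * |G S| := by
          refine Finset.sum_le_sum fun n _ => (Finset.abs_sum_le_sum_abs _ _).trans (le_of_eq ?_)
          exact Finset.sum_congr rfl fun S _ => abs_mul _ _
      _ = ∑ S ∈ (Finset.univ : Finset ι).powerset.erase ∅, |F S| * |G S| := by linarith
  -- Cauchy–Schwarz over `S ≠ ∅`
  have hstep2 : ∑ S ∈ (Finset.univ : Finset ι).powerset.erase ∅, |F S| * |G S|
      ≤ Real.sqrt (∑ S ∈ (Finset.univ : Finset ι).powerset.erase ∅, F S ^ 2)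
        * Real.sqrt (∑ S ∈ (Finset.univ : Finset ι).powerset.erase ∅, G S ^ 2) := by
    have h := Real.sum_mul_le_sqrt_mul_sqrt ((Finset.univ : Finset ι).powerset.erase ∅) (fun S => |F S|) (fun S => |G S|)
    simp only [sq_abs] at h
    exact h
  -- Parseval: `Σ_{S ≠ ∅} F(S)² = E f² − (E f)²`
  have hparsF : ∑ S ∈ (Finset.univ : Finset ι).powerset.erase ∅, F S ^ 2
      = (∑ x : ι → Bool, wt p x * (f x * f x)) - (∑ x : ι → Bool, wt p x * f x) ^ 2 := by
    have h := sum_wt_mul_sq_eq_sum_coeff_sq hH2 f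
    simp only [hFS] at h
    rw [h, ← Finset.add_sum_erase _ _ (Finset.empty_mem_powerset (Finset.univ : Finset ι))]
    have : F ∅ = ∑ x : ι → Bool, wt p x * f x := by rw [hF]; simp
    rw [this]; ring
  have hparsG : ∑ S ∈ (Finset.univ : Finset ι).powerset.erase ∅, G S ^ 2
      = (∑ x : ι → Bool, wt p x * (g x * g x)) - (∑ x : ι → Bool, wt p x * g x) ^ 2 := by
    have h := sum_wt_mul_sq_eq_sum_coeff_sq hH2 g
    simp only [hGS] at h
    rw [h, ← Finset.add_sum_erase _ _ (Finset.empty_mem_powerset (Finset.univ : Finset ι))]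
    have : G ∅ = ∑ x : ι → Bool, wt p x * g x := by rw [hG]; simp
    rw [this]; ring
  rw [← hparsF, ← hparsG]
  exact hstep1.trans hstep2

end Characters

/-! ## §2 The quantitative Harris inequality with logarithmic loss -/

section Consequences

variable (p : ι → ℝ) (h0 : ∀ i, 0 ≤ p i) (h1 : ∀ i, p i ≤ 1)

include h0 h1 in
/-- **THE QUANTITATIVE HARRIS INEQUALITY WITH LOGARITHMIC LOSS (De–Nadimpalli–Servedio, explicit constants), every `p ∈ [0,1]^ι`.**
For coordinatewise non-decreasing real `f, g` on the p-biased cube, with `a₁ = Σ_i p_i(1−p_i)·E[D_i f]·E[D_i g]` (the `p(1−p)`-weighted inner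
product of the influence vectors; `D_i h(x) = h(x^{i→1}) − h(x^{i→0})`) and `σ_h² = E h² − (E h)²`:
**`E[f·g] − E[f]·E[g] ≥ a₁ / (40·log²(max(e², σ_f σ_g / a₁)))`**.  (When `a₁ = 0` the right side is `0` and this is Harris' inequality.)
Proof: the correlation function `q(t) = E[f(ω)g(ω^{1−t})] = Σ_ℓ a_ℓ t^ℓ` is non-decreasing on `[0,1]` (gen 23), so `p(t) = (q(t) − q(0))/a₁` has
`c_1 = 1`, `0 ≤ p ≤ p(1) = Cov/a₁` on `[0,1]` and length `≤ σ_f σ_g/a₁`; apply the extremal lemma of part I.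
[cite: DeNadimpalliServedio2021, Thm 15 and §6 Thm 41 (Φ(x) = min(x, x/log²(1/x)); here with explicit constants)] -/
theorem cov_ge_level_one_div_log_sq (f g : (ι → Bool) → ℝ)
    (hf : ∀ i x, f (update x i false) ≤ f (update x i true)) (hg : ∀ i x, g (update x i false) ≤ g (update x i true)) :
    (∑ i, p i * (1 - p i) * ((∑ x : ι → Bool, wt p x * (f (update x i true) - f (update x i false)))
        * (∑ x : ι → Bool, wt p x * (g (update x i true) - g (update x i false)))))
      / (40 * Real.log (max (Real.exp 2)
          (Real.sqrt ((∑ x : ι → Bool, wt p x * (f x * f x)) - (∑ x : ι → Bool, wt p x * f x) ^ 2)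
            * Real.sqrt ((∑ x : ι → Bool, wt p x * (g x * g x)) - (∑ x : ι → Bool, wt p x * g x) ^ 2)
            / (∑ i, p i * (1 - p i) * ((∑ x : ι → Bool, wt p x * (f (update x i true) - f (update x i false)))
                * (∑ x : ι → Bool, wt p x * (g (update x i true) - g (update x i false))))))) ^ 2)
      ≤ ∑ x : ι → Bool, wt p x * (f x * g x) - (∑ x : ι → Bool, wt p x * f x) * (∑ x : ι → Bool, wt p x * g x) := by
  have hH1 := pbiased_H1 p
  have hH2 := pbiased_H2 p h0 h1
  set r : ι → Bool → ℝ := fun j b => (((if b then (1 : ℝ) else 0) - p j) / Real.sqrt (p j * (1 - p j))) with hr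
  -- the levels `a_ℓ`
  obtain ⟨a, ha⟩ : ∃ a : ℕ → ℝ, a = fun ℓ => ∑ S ∈ Finset.powersetCard ℓ (Finset.univ : Finset ι),
      (∑ x : ι → Bool, wt p x * (f x * ∏ i ∈ S, r i (x i))) * (∑ x : ι → Bool, wt p x * (g x * ∏ i ∈ S, r i (x i))) := ⟨_, rfl⟩
  -- the influence inner product `a₁`, the standard deviations
  set A₁ : ℝ := ∑ i, p i * (1 - p i) * ((∑ x : ι → Bool, wt p x * (f (update x i true) - f (update x i false)))
        * (∑ x : ι → Bool, wt p x * (g (update x i true) - g (update x i false)))) with hA₁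
  set σf : ℝ := Real.sqrt ((∑ x : ι → Bool, wt p x * (f x * f x)) - (∑ x : ι → Bool, wt p x * f x) ^ 2) with hσf
  set σg : ℝ := Real.sqrt ((∑ x : ι → Bool, wt p x * (g x * g x)) - (∑ x : ι → Bool, wt p x * g x) ^ 2) with hσg
  have ha1 : a 1 = A₁ := by rw [ha, hA₁]; exact level_one_eq hH1 hH2 f g
  have ha0 : a 0 = (∑ x : ι → Bool, wt p x * f x) * (∑ x : ι → Bool, wt p x * g x) := by rw [ha]; exact level_zero_eq f g
  -- the correlation function `q(t)` and `p(t) = q(t) − q(0) = Σ_{i < n} a_{i+1} t^{i+1}`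
  set n : ℕ := Fintype.card ι with hn
  have hq : ∀ t : ℝ, ∑ x : ι → Bool, ∑ y : ι → Bool, ∑ m : ι → Bool, wt p x * wt p y * wt (fun _ => 1 - t) m
        * (f x * g (fun i => if m i = true then y i else x i))
      = a 0 + ∑ i ∈ Finset.range n, a (i + 1) * t ^ (i + 1) := by
    intro t
    rw [noise_cross_correlation_eq_sum_levels hH1 hH2 f g t, Finset.sum_range_succ', pow_zero, one_mul, ha]
    rw [add_comm]
    congr 1
    exact Finset.sum_congr rfl fun i _ => mul_comm _ _
  -- values at `t = 1` and `t = 0`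
  have hq1 : ∑ x : ι → Bool, wt p x * (f x * g x) = a 0 + ∑ i ∈ Finset.range n, a (i + 1) * (1 : ℝ) ^ (i + 1) := by
    rw [← hq 1, show (1 : ℝ) - 1 = 0 by norm_num]; exact (noise_zero_eq p f g).symm
  have hcov : ∑ x : ι → Bool, wt p x * (f x * g x) - (∑ x : ι → Bool, wt p x * f x) * (∑ x : ι → Bool, wt p x * g x)
      = ∑ i ∈ Finset.range n, a (i + 1) := by
    rw [hq1, ha0]; simp
  -- monotonicity: `0 ≤ p(t) ≤ p(1)` on `[0,1]`
  have hmono : ∀ t : ℝ, 0 ≤ t → t ≤ 1 →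
      0 ≤ ∑ i ∈ Finset.range n, a (i + 1) * t ^ (i + 1)
        ∧ ∑ i ∈ Finset.range n, a (i + 1) * t ^ (i + 1) ≤ ∑ i ∈ Finset.range n, a (i + 1) := by
    intro t ht0 ht1
    have hlow := noise_cross_correlation_antitone p h0 h1 f g hf hg (a := 1 - t) (b := 1) (by linarith) (by linarith) le_rfl
    have hup := noise_cross_correlation_antitone p h0 h1 f g hf hg (a := 0) (b := 1 - t) le_rfl (by linarith) (by linarith)
    rw [hq t] at hlow hup
    rw [show (1 : ℝ) = 1 - 0 by norm_num, hq 0] at hlow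
    rw [show (0 : ℝ) = 1 - 1 by norm_num, hq 1] at hup
    simp only [ne_eq, add_eq_zero, one_ne_zero, and_false, not_false_eq_true, zero_pow, mul_zero, Finset.sum_const_zero,
      add_zero, one_pow, mul_one] at hlow hup
    constructor <;> linarith
  -- `a₁ ≥ 0`
  have hA₁nn : 0 ≤ A₁ := by
    rw [hA₁]
    refine Finset.sum_nonneg fun i _ => mul_nonneg (mul_nonneg (h0 i) (by linarith [h1 i])) (mul_nonneg ?_ ?_)
    · exact Finset.sum_nonneg fun x _ => mul_nonneg (wt_nonneg h0 h1 x) (by linarith [hf i x])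
    · exact Finset.sum_nonneg fun x _ => mul_nonneg (wt_nonneg h0 h1 x) (by linarith [hg i x])
  rcases hA₁nn.lt_or_eq with hA₁pos | hA₁zero
  swap
  · -- `a₁ = 0`: Harris' inequality
    rw [← hA₁zero, zero_div]
    linarith [harris_of_monotone p h0 h1 f g hf hg]
  -- `a₁ > 0`: the extremal lemma for `c_ℓ = a_ℓ / a₁`
  have hn1 : 1 ≤ n := by
    by_contra hlt
    have hn0 : n = 0 := by omega
    have : IsEmpty ι := Fintype.card_eq_zero_iff.1 (hn ▸ hn0)
    have hz : A₁ = 0 := by rw [hA₁]; exact Finset.sum_eq_zero fun i _ => (IsEmpty.false i).elim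
    linarith
  obtain ⟨c, hc⟩ : ∃ c : ℕ → ℝ, c = fun ℓ => a ℓ / A₁ := ⟨_, rfl⟩
  have hc1 : c 1 = 1 := by rw [hc]; simp only; rw [ha1, div_self hA₁pos.ne']
  -- length
  have hlen : ∑ i ∈ Finset.range n, |c (i + 1)| ≤ σf * σg / A₁ := by
    have h : ∑ i ∈ Finset.range n, |a (i + 1)| ≤ σf * σg := by
      rw [ha, hσf, hσg]; exact sum_abs_level_le hH2 f g
    have : ∑ i ∈ Finset.range n, |c (i + 1)| = (∑ i ∈ Finset.range n, |a (i + 1)|) / A₁ := by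
      rw [hc, Finset.sum_div]
      exact Finset.sum_congr rfl fun i _ => by rw [abs_div, abs_of_pos hA₁pos]
    rw [this]
    exact div_le_div_of_nonneg_right h hA₁pos.le
  -- `|p(t)| ≤ p(1)`
  have hsum_c : ∀ t : ℝ, ∑ i ∈ Finset.range n, c (i + 1) * t ^ (i + 1) = (∑ i ∈ Finset.range n, a (i + 1) * t ^ (i + 1)) / A₁ := by
    intro t; rw [hc, Finset.sum_div]; exact Finset.sum_congr rfl fun i _ => by ring
  have hc_one : ∑ i ∈ Finset.range n, c (i + 1) = (∑ i ∈ Finset.range n, a (i + 1)) / A₁ := by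
    rw [hc, Finset.sum_div]
  have hbound : ∀ t : ℝ, 0 ≤ t → t ≤ 1 →
      |∑ i ∈ Finset.range n, c (i + 1) * t ^ (i + 1)| ≤ ∑ i ∈ Finset.range n, c (i + 1) := by
    intro t ht0 ht1
    obtain ⟨hl, hu⟩ := hmono t ht0 ht1
    rw [hsum_c, hc_one, abs_div, abs_of_pos hA₁pos, abs_of_nonneg hl]
    exact div_le_div_of_nonneg_right hu hA₁pos.le
  have key := Extremal.eval_one_ge_of_monotone c hn1 hc1 hlen hbound
  rw [hc_one, le_div_iff₀ hA₁pos] at key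
  have h40 : 0 < 40 * Real.log (max (Real.exp 2) (σf * σg / A₁)) ^ 2 := by
    have : 2 ≤ Real.log (max (Real.exp 2) (σf * σg / A₁)) := by
      calc (2 : ℝ) = Real.log (Real.exp 2) := (Real.log_exp 2).symm
        _ ≤ _ := Real.log_le_log (Real.exp_pos 2) (le_max_left _ _)
    positivity
  rw [hcov, div_le_iff₀ h40]
  have h' := mul_le_mul_of_nonneg_right key h40.le
  have hAeq : 1 / (40 * Real.log (max (Real.exp 2) (σf * σg / A₁)) ^ 2) * A₁
      * (40 * Real.log (max (Real.exp 2) (σf * σg / A₁)) ^ 2) = A₁ := by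
    rw [one_div, mul_assoc, mul_comm A₁, ← mul_assoc, inv_mul_cancel₀ h40.ne', one_mul]
  rw [hAeq] at h'
  exact h'

include h0 h1 in
/-- **The same with an a-priori bound on the standard deviations**: if `σ_f σ_g ≤ V` (e.g. `V = 1/4` for two indicators, `V = 1` for
`[−1,1]`-valued functions) then **`E[fg] − E[f]E[g] ≥ a₁ / (40·log²(max(e², V/a₁)))`** — the form used on the lattice (part III).
[cite: DeNadimpalliServedio2021, Thm 15 (‖f‖, ‖g‖ ≤ 1)] -/
theorem cov_ge_level_one_div_log_sq_of_le (f g : (ι → Bool) → ℝ)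
    (hf : ∀ i x, f (update x i false) ≤ f (update x i true)) (hg : ∀ i x, g (update x i false) ≤ g (update x i true))
    {V : ℝ} (hV : Real.sqrt ((∑ x : ι → Bool, wt p x * (f x * f x)) - (∑ x : ι → Bool, wt p x * f x) ^ 2)
            * Real.sqrt ((∑ x : ι → Bool, wt p x * (g x * g x)) - (∑ x : ι → Bool, wt p x * g x) ^ 2) ≤ V) :
    (∑ i, p i * (1 - p i) * ((∑ x : ι → Bool, wt p x * (f (update x i true) - f (update x i false)))
        * (∑ x : ι → Bool, wt p x * (g (update x i true) - g (update x i false)))))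
      / (40 * Real.log (max (Real.exp 2)
          (V / (∑ i, p i * (1 - p i) * ((∑ x : ι → Bool, wt p x * (f (update x i true) - f (update x i false)))
                * (∑ x : ι → Bool, wt p x * (g (update x i true) - g (update x i false))))))) ^ 2)
      ≤ ∑ x : ι → Bool, wt p x * (f x * g x) - (∑ x : ι → Bool, wt p x * f x) * (∑ x : ι → Bool, wt p x * g x) := by
  have h := cov_ge_level_one_div_log_sq p h0 h1 f g hf hg
  set A₁ : ℝ := ∑ i, p i * (1 - p i) * ((∑ x : ι → Bool, wt p x * (f (update x i true) - f (update x i false)))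
        * (∑ x : ι → Bool, wt p x * (g (update x i true) - g (update x i false)))) with hA₁
  set S : ℝ := Real.sqrt ((∑ x : ι → Bool, wt p x * (f x * f x)) - (∑ x : ι → Bool, wt p x * f x) ^ 2)
            * Real.sqrt ((∑ x : ι → Bool, wt p x * (g x * g x)) - (∑ x : ι → Bool, wt p x * g x) ^ 2) with hS
  have hA₁nn : 0 ≤ A₁ := by
    rw [hA₁]
    refine Finset.sum_nonneg fun i _ => mul_nonneg (mul_nonneg (h0 i) (by linarith [h1 i])) (mul_nonneg ?_ ?_)
    · exact Finset.sum_nonneg fun x _ => mul_nonneg (wt_nonneg h0 h1 x) (by linarith [hf i x])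
    · exact Finset.sum_nonneg fun x _ => mul_nonneg (wt_nonneg h0 h1 x) (by linarith [hg i x])
  refine le_trans ?_ h
  rcases hA₁nn.lt_or_eq with hpos | hzero
  swap
  · rw [← hzero]; simp
  -- compare the logarithms: `max(e², S/A₁) ≤ max(e², V/A₁)`
  have h2 : (2 : ℝ) ≤ Real.log (max (Real.exp 2) (S / A₁)) := by
    calc (2 : ℝ) = Real.log (Real.exp 2) := (Real.log_exp 2).symm
      _ ≤ _ := Real.log_le_log (Real.exp_pos 2) (le_max_left _ _)
  have hlogle : Real.log (max (Real.exp 2) (S / A₁)) ≤ Real.log (max (Real.exp 2) (V / A₁)) :=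
    Real.log_le_log (lt_of_lt_of_le (Real.exp_pos 2) (le_max_left _ _))
      (max_le_max le_rfl (div_le_div_of_nonneg_right hV hpos.le))
  have hpos1 : 0 < 40 * Real.log (max (Real.exp 2) (S / A₁)) ^ 2 := by positivity
  exact div_le_div_of_nonneg_left hA₁nn hpos1 (by gcongr)

end Consequences

end Summit.CriticalPhenomena.PercolationContinuityZ3.Theorems.Crossing.Spectral

end
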